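import Summits.RiemannHypothesis.RiemannHypothesis.Theorems.HandoffSemilocalEnergy
import Summits.RiemannHypothesis.RiemannHypothesis.Theorems.MotivicDoorSemilocalClosed
import Literature.NumberTheory.LFunctions.WeilWindowSuzukiContinuityProofs
import HarnessLib

/-!
# TRACK «HANDOFF» — the semi-local form under Bombieri's dilation: a UNIFORM modulus on energy-bounded parts of the unit sphere (theory-1 gen5, file XI-a)

Cell `rh-explicit`, seat handoff-theory-1 (H-T, statement owner).  Part 1/2 of the answer to `HANDOFF-STATEMENT.md` §B.4 (ii)
(b): continuity of the semi-local bottom `t ↦ λ_min(S; t)` in the window, for every finite set of primes `S`.  This file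
is the analytic input; part 2/2 (`HandoffSemilocalContinuity.lean`) draws continuity, the exact zero at the wall, and
«RH ⟹ every wall offset is STRICTLY positive».

* §1 the integer window above `b` (`lt_log_floor_exp_add_one`); Bombieri's Lemma-3 bound for the `S`-restricted prime
  term is the tree's `norm_weilSemilocalPrimeTerm_le_of_tsupport_subset` (`WeilSemilocalFiniteCodimension.lean`), reused.
* §2 `re_weilSemilocalQuadratic_weilDilate_sub` — under Bombieri's unitary dilation `g_η`, `Re Q_S(g_η) − Re Q_S(g)`
  = `(Re Q(g_η) − Re Q(g))` + (the NON-`S`-smooth prime powers of the difference kernel `d = k((1+η)·) − k`, `k = g ⋆ g̃`).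
* §3 `exists_semilocalDilate_modulus` — **the uniform dilation modulus of `Q_S`** on energy-bounded parts of the unit
  sphere of a window: the full form's modulus (`exists_weilDilate_modulus`, the tree's minimiser-free proof of Suzuki 2026
  Thm 1.3) plus the translation modulus of energy-bounded functions (`two_pi_mul_weilIncrement_le`, `norm_dilate_sub_le`)
  for the finitely many missing prime powers; the energies transfer because `Q` and `Q_S` differ by a bounded form on
  each window (`weilQuadratic_re_le_weilSemilocalQuadratic_re_add`).

HONEST FRAMING. Nothing here bears on the truth of RH; these are unconditional structural facts about the tree's
semi-local forms `Q_S` (`WeilSemilocalQuadratic.lean`).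

References: M. Suzuki, arXiv:2606.09096 (2026) Thm 1.3, §4 (key `Suzuki2026`; the mechanism, via the tree's proof file);
E. Bombieri, Rend. Mat. Acc. Lincei (9) 11 (2000) §4 Lemma 3, Thm 5 (key `Bombieri2000Weil`); A. Connes, Selecta Math. 5
(1999) §VII Thm 4 (the semi-local Weil sum, key `Connes1999`).
-/

set_option linter.dupNamespace false  -- the mandated namespace repeats `RiemannHypothesis`

noncomputable section

open Set Filter Complex MeasureTheory Literature.NumberTheory.LFunctions
open Literature.Analysis.SpecialFunctions
open Summit.RiemannHypothesis.RiemannHypothesis.Theorems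
open Summit.RiemannHypothesis.RiemannHypothesis.Theorems.MotivicDoor.Semilocal
open Summit.RiemannHypothesis.RiemannHypothesis.Theorems.MotivicDoor.SemilocalThreshold
open scoped Real Topology ComplexConjugate ArithmeticFunction.vonMangoldt

namespace Summit.RiemannHypothesis.RiemannHypothesis.Theorems.HandoffSemilocalEnergy

variable {g : ℝ → ℂ} {S : Finset ℕ} {a η : ℝ}

/-! ## §1  The integer window above a support bound -/

/-- `b < log (⌊e^b⌋ + 1)` (the integer window just above `b`). [folklore] -/
theorem lt_log_floor_exp_add_one (b : ℝ) : b < Real.log ((⌊Real.exp b⌋₊ : ℝ) + 1) := by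
  have h1 : Real.exp b < (⌊Real.exp b⌋₊ : ℝ) + 1 := Nat.lt_floor_add_one _
  have h2 := Real.log_lt_log (Real.exp_pos b) h1
  rwa [Real.log_exp] at h2

/-! ## §2  The semi-local form under Bombieri's dilation -/

/-- The `S`-restricted prime terms of `k((1+η)·)` and `k` (`k = g ⋆ g̃`, `tsupport g ⊆ [−a, a]`, `|η| ≤ 1/2`) differ by
that of the difference kernel (all three are FINITE sums over `n ≤ e^{4a}`). [folklore] -/
theorem weilSemilocalPrimeTerm_dilate_sub (S : Finset ℕ) (hg : IsWeilTest g) (ha : 0 < a)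
    (hsupp : tsupport g ⊆ Icc (-a) a) (hη : |η| ≤ 1 / 2) :
    weilSemilocalPrimeTerm S (fun t ↦ weilConv g (weilReflect g) ((1 + η) * t)) -
        weilSemilocalPrimeTerm S (weilConv g (weilReflect g)) =
      weilSemilocalPrimeTerm S
        ((fun t ↦ weilConv g (weilReflect g) ((1 + η) * t)) - weilConv g (weilReflect g)) := by
  set k : ℝ → ℂ := weilConv g (weilReflect g) with hk
  have hη1 : -1 < η := by linarith [neg_abs_le η]
  have hc : 0 < 1 + η := by linarith
  have hkt : IsWeilTest k := hg.weilConv hg.weilReflect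
  have hks : tsupport k ⊆ Icc (-(2 * a)) (2 * a) := tsupport_weilConv_weilReflect_subset hg.2 hsupp
  have hks4 : tsupport k ⊆ Icc (-(4 * a)) (4 * a) :=
    hks.trans (Icc_subset_Icc (by linarith) (by linarith))
  have hkct : IsWeilTest (fun t ↦ k ((1 + η) * t)) := hkt.comp_mul hc.ne'
  have hdiv : 2 * a / (1 + η) ≤ 4 * a := by
    rw [div_le_iff₀ hc]
    nlinarith [neg_abs_le η, ha]
  have hkcs : tsupport (fun t ↦ k ((1 + η) * t)) ⊆ Icc (-(4 * a)) (4 * a) :=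
    (tsupport_comp_mul_subset k hc hks).trans (Icc_subset_Icc (by linarith) hdiv)
  have hdt : IsWeilTest ((fun t ↦ k ((1 + η) * t)) - k) := isWeilTest_dilate_sub hg hη1
  have hds : tsupport ((fun t ↦ k ((1 + η) * t)) - k) ⊆ Icc (-(4 * a)) (4 * a) :=
    tsupport_dilate_sub_subset hg hsupp hη
  set N : ℕ := ⌊Real.exp (4 * a)⌋₊ with hN
  have h4 : 4 * a ≤ Real.log ((N : ℝ) + 1) := (lt_log_floor_exp_add_one (4 * a)).le
  have hI : Icc (-(4 * a)) (4 * a) ⊆ Icc (-Real.log ((N : ℝ) + 1)) (Real.log ((N : ℝ) + 1)) :=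
    Icc_subset_Icc (neg_le_neg h4) h4
  rw [weilSemilocalPrimeTerm_eq_sum_of_tsupport_subset S hkct.1.continuous N (hkcs.trans hI),
    weilSemilocalPrimeTerm_eq_sum_of_tsupport_subset S hkt.1.continuous N (hks4.trans hI),
    weilSemilocalPrimeTerm_eq_sum_of_tsupport_subset S hdt.1.continuous N (hds.trans hI),
    ← Finset.sum_sub_distrib]
  refine Finset.sum_congr rfl fun n _ ↦ ?_
  simp only [Pi.sub_apply]
  ring

/-- **The semi-local form under a dilation.** For a test function `g` on `[−a, a]`, `a > 0`, `|η| ≤ 1/2`, with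
`k = g ⋆ g̃` and `d = k((1+η)·) − k`:
`Re Q_S(g_η) − Re Q_S(g) = (Re Q(g_η) − Re Q(g)) + Re Pr(d) − Re Pr_S(d)`
(`Q_S = Q + (Pr − Pr_S)` on autocorrelations, `weilSemilocalFunctional_eq_weilFunctional_add`; `Q(g_η) = W(k((1+η)·))`,
`Q_S(g_η) = W_S(k((1+η)·))`). [cite: Bombieri2000Weil, §4 proof of Thm 5 (the dilation), with the primes restricted to S] -/
theorem re_weilSemilocalQuadratic_weilDilate_sub (S : Finset ℕ) (hg : IsWeilTest g) (ha : 0 < a)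
    (hsupp : tsupport g ⊆ Icc (-a) a) (hη : |η| ≤ 1 / 2) :
    (weilSemilocalQuadratic S (weilDilate η g)).re - (weilSemilocalQuadratic S g).re =
      ((weilQuadratic (weilDilate η g)).re - (weilQuadratic g).re) +
        (weilPrimeTerm ((fun t ↦ weilConv g (weilReflect g) ((1 + η) * t)) -
          weilConv g (weilReflect g))).re -
        (weilSemilocalPrimeTerm S ((fun t ↦ weilConv g (weilReflect g) ((1 + η) * t)) -
          weilConv g (weilReflect g))).re := by
  have hη1 : -1 < η := by linarith [neg_abs_le η]
  have hPrS := weilSemilocalPrimeTerm_dilate_sub S hg ha hsupp hη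
  set k : ℝ → ℂ := weilConv g (weilReflect g) with hk
  have hkt : IsWeilTest k := hg.weilConv hg.weilReflect
  have hc0 : (1 + η) ≠ 0 := ne_of_gt (by linarith)
  have hkct : IsWeilTest (fun t ↦ k ((1 + η) * t)) := hkt.comp_mul hc0
  have hPr : weilPrimeTerm ((fun t ↦ k ((1 + η) * t)) - k) =
      weilPrimeTerm (fun t ↦ k ((1 + η) * t)) - weilPrimeTerm k :=
    weilPrimeTerm_sub hkct.2 hkt.2
  have hQS : weilSemilocalQuadratic S g =
      weilFunctional k + (weilPrimeTerm k - weilSemilocalPrimeTerm S k) := by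
    show weilSemilocalFunctional S k = _
    exact weilSemilocalFunctional_eq_weilFunctional_add S k
  have hQ : weilQuadratic g = weilFunctional k := rfl
  rw [weilSemilocalQuadratic_weilDilate S g hη1, weilQuadratic_weilDilate g hη1,
    weilSemilocalFunctional_eq_weilFunctional_add, hPr, ← hPrS, hQS, hQ]
  simp only [Complex.add_re, Complex.sub_re]
  ring

/-! ## §3  The uniform dilation modulus of `Q_S` -/

/-- **KEY (uniform continuity of `Q_S` under small dilations, on energy-bounded parts of the unit sphere of a window).**
For every finite `S`, window `a > 0`, energy cap `E` and `ε > 0` there is `δ ∈ (0, 1/2]` such that for every `|η| ≤ δ`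
and every `L²`-normalised test function `g` on `[−a, a]` with `Re Q_S(g) ≤ E`: `|Re Q_S(g_η) − Re Q_S(g)| ≤ ε`.
Proof: `Re Q(g) ≤ E + 4Σ_{n ≤ e^{2a}} Λ(n)/√n` (the forms differ by a bounded form), so the tree's uniform modulus of
the FULL form applies; the finitely many non-`S`-smooth prime powers change by prime terms of the difference kernel
`d`, bounded pointwise by the translation modulus of `g`, which is uniformly small on energy-bounded sets
(`two_pi_mul_weilIncrement_le`: the tail mass of `|ĝ|²` is `≤ B/(ρ(M) − ρ(0))`, `B ≤ 2π(Re Q + C(a))`).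
[cite: Suzuki2026, §4.3–§4.4 (proof of Thm. 1.3), mechanism; Bombieri2000Weil §4 Lemma 3, Thm 5] -/
theorem exists_semilocalDilate_modulus (S : Finset ℕ) {a : ℝ} (ha : 0 < a) (E : ℝ) {ε : ℝ} (hε : 0 < ε) :
    ∃ δ : ℝ, 0 < δ ∧ δ ≤ 1 / 2 ∧ ∀ η : ℝ, |η| ≤ δ → ∀ g : ℝ → ℂ, IsWeilTest g →
      tsupport g ⊆ Icc (-a) a → ∫ t : ℝ, ‖g t‖ ^ 2 = (1 : ℝ) → (weilSemilocalQuadratic S g).re ≤ E →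
        |(weilSemilocalQuadratic S (weilDilate η g)).re - (weilSemilocalQuadratic S g).re| ≤ ε := by
  -- constants of the window (opaque reals with defining equations)
  obtain ⟨S₂, hS₂⟩ : ∃ S₂ : ℝ, S₂ = ∑ n ∈ Finset.range (⌊Real.exp (2 * a)⌋₊ + 1),
    (Λ n : ℝ) / Real.sqrt n := ⟨_, rfl⟩
  obtain ⟨S₄, hS₄⟩ : ∃ S₄ : ℝ, S₄ = ∑ n ∈ Finset.range (⌊Real.exp (4 * a)⌋₊ + 1),
    (Λ n : ℝ) / Real.sqrt n := ⟨_, rfl⟩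
  have hΛ : ∀ n : ℕ, (0 : ℝ) ≤ (Λ n : ℝ) / Real.sqrt n := fun n ↦
    div_nonneg ArithmeticFunction.vonMangoldt_nonneg (Real.sqrt_nonneg _)
  have hS₂0 : 0 ≤ S₂ := hS₂ ▸ Finset.sum_nonneg fun n _ ↦ hΛ n
  have hS₄0 : 0 ≤ S₄ := hS₄ ▸ Finset.sum_nonneg fun n _ ↦ hΛ n
  obtain ⟨E', hE'⟩ : ∃ E' : ℝ, E' = E + 4 * S₂ := ⟨_, rfl⟩
  -- the full form's modulus at the transferred energy cap
  obtain ⟨δ₁, hδ₁0, -, h₁⟩ := exists_weilDilate_modulus ha E' (half_pos hε)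
  -- the `H^{log}` energy bound
  obtain ⟨C, hC⟩ : ∃ C : ℝ, C = 2 * (Real.sinh a - a) + 2 * S₂ + Real.log π - reDigammaQuarter 0 :=
    ⟨_, rfl⟩
  obtain ⟨Bbar, hBbar⟩ : ∃ Bbar : ℝ, Bbar = max 0 (2 * π * (E' + C)) := ⟨_, rfl⟩
  have hBbar0 : 0 ≤ Bbar := by rw [hBbar]; exact le_max_left _ _
  have hBbar1 : 2 * π * (E' + C) ≤ Bbar := by rw [hBbar]; exact le_max_right _ _
  -- the choice of `λ`
  have hS1 : 0 < S₄ + 1 := by linarith only [hS₄0]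
  obtain ⟨lam, hlam⟩ : ∃ lam : ℝ, lam = ε / (16 * (S₄ + 1)) := ⟨_, rfl⟩
  have hlam0 : 0 < lam := by rw [hlam]; positivity
  have hlamS : 4 * S₄ * lam ≤ ε / 4 := by
    rw [hlam, mul_div_assoc', div_le_div_iff₀ (by positivity) (by positivity)]
    nlinarith only [hε, hS₄0]
  -- the choice of `M`
  have hRt : Tendsto (fun M : ℝ ↦ reDigammaQuarter M - reDigammaQuarter 0) atTop atTop :=
    tendsto_atTop_add_const_right _ _ tendsto_reDigammaQuarter_atTop
  have hlim : Tendsto (fun M : ℝ ↦ (2 * Bbar / π) / (reDigammaQuarter M - reDigammaQuarter 0))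
      atTop (𝓝 0) := tendsto_const_nhds.div_atTop hRt
  obtain ⟨M, hM, hM1⟩ : ∃ M : ℝ, 0 < reDigammaQuarter M - reDigammaQuarter 0 ∧
      (2 * Bbar / π) / (reDigammaQuarter M - reDigammaQuarter 0) ≤ lam ^ 2 / 2 :=
    ((hRt.eventually_gt_atTop 0).and (hlim.eventually (Iic_mem_nhds (by positivity)))).exists
  have hM' : reDigammaQuarter 0 < reDigammaQuarter M := sub_pos.1 hM
  obtain ⟨R, hR⟩ : ∃ R : ℝ, R = reDigammaQuarter M - reDigammaQuarter 0 := ⟨_, rfl⟩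
  rw [← hR] at hM hM1
  -- the choice of `δ`
  obtain ⟨P, hP⟩ : ∃ P : ℝ, P = 16 * a ^ 2 * M ^ 2 := ⟨_, rfl⟩
  have hP0 : 0 ≤ P := by rw [hP]; positivity
  obtain ⟨δ, hδ⟩ : ∃ δ : ℝ, δ = min (1 / 2) (min δ₁ (lam ^ 2 / (2 * (P + 1)))) := ⟨_, rfl⟩
  have hδ0 : 0 < δ := by rw [hδ]; positivity
  have hδ1 : δ ≤ 1 / 2 := by rw [hδ]; exact min_le_left _ _
  have hδ2 : δ ≤ δ₁ := by rw [hδ]; exact (min_le_right _ _).trans (min_le_left _ _)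
  have hδ3 : δ ≤ lam ^ 2 / (2 * (P + 1)) := by rw [hδ]; exact (min_le_right _ _).trans (min_le_right _ _)
  refine ⟨δ, hδ0, hδ1, fun η hη g hg hsupp hN hE ↦ ?_⟩
  have hη2 : |η| ≤ 1 / 2 := hη.trans hδ1
  have hη1 : -1 < η := by linarith [neg_abs_le η]
  rw [re_weilSemilocalQuadratic_weilDilate_sub S hg ha hsupp hη2]
  -- the full form: energy transfer and the tree's modulus
  have hEfull : (weilQuadratic g).re ≤ E' := by
    have h := weilQuadratic_re_le_weilSemilocalQuadratic_re_add S hg hsupp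
    rw [hN, mul_one, ← hS₂] at h
    rw [hE']
    linarith
  have hfull : |(weilQuadratic (weilDilate η g)).re - (weilQuadratic g).re| ≤ ε / 2 :=
    h₁ η (hη.trans hδ2) g hg hsupp hN hEfull
  -- the energy `B ≤ B̄`
  obtain ⟨B, hB⟩ : ∃ B : ℝ, B = ∫ u : ℝ, ‖weilMellin g (1 / 2 + u * I)‖ ^ 2 *
    (reDigammaQuarter u - reDigammaQuarter 0) := ⟨_, rfl⟩
  have hB0 : 0 ≤ B := hB ▸ integral_nonneg fun u ↦
    mul_nonneg (sq_nonneg _) (sub_nonneg.2 (reDigammaQuarter_zero_le u))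
  have hBle : B ≤ Bbar := by
    have h := integral_norm_sq_weilMellin_mul_sub_le hg hsupp
    rw [hN, mul_one, ← hS₂, ← hC, ← hB] at h
    exact h.trans ((mul_le_mul_of_nonneg_left (by linarith only [hEfull]) (by positivity)).trans hBbar1)
  -- the translation modulus at lengths `≤ 4a|η|`
  have hP2 : ∫ u : ℝ, ‖weilMellin g (1 / 2 + u * I)‖ ^ 2 = 2 * π := by
    rw [integral_norm_sq_weilMellin_half_line hg]
    unfold weilNorm2Sq
    rw [hN, mul_one]
  obtain ⟨X, hX⟩ : ∃ X : ℝ, X = 16 * a ^ 2 * η ^ 2 * M ^ 2 + 2 * B / (π * R) := ⟨_, rfl⟩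
  have hXmod : ∀ h : ℝ, |h| ≤ 4 * a * |η| → weilIncrement g h ≤ X := by
    intro h hh
    have h1 := two_pi_mul_weilIncrement_le hg h hM'
    rw [hP2, ← hB, ← hR] at h1
    have hh2 : h ^ 2 ≤ (4 * a * |η|) ^ 2 := by
      rw [← sq_abs h]; exact pow_le_pow_left₀ (abs_nonneg h) hh 2
    have hh3 : (4 * a * |η|) ^ 2 = 16 * a ^ 2 * η ^ 2 := by rw [mul_pow, sq_abs]; ring
    have hπ : 0 < π := Real.pi_pos
    have h2 : weilIncrement g h ≤ h ^ 2 * M ^ 2 + 2 * B / (π * R) := by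
      have e : (4 / R * B) = 2 * π * (2 * B / (π * R)) := by
        field_simp
        ring
      rw [e, show h ^ 2 * M ^ 2 * (2 * π) = 2 * π * (h ^ 2 * M ^ 2) by ring, ← mul_add] at h1
      exact le_of_mul_le_mul_left h1 (by positivity)
    have h3 : h ^ 2 * M ^ 2 ≤ 16 * a ^ 2 * η ^ 2 * M ^ 2 := by
      rw [← hh3]; exact mul_le_mul_of_nonneg_right hh2 (sq_nonneg M)
    rw [hX]
    linarith
  -- `X ≤ λ²`
  have hXle : X ≤ lam ^ 2 := by
    have h1 : η ^ 2 ≤ δ := by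
      have h' : η ^ 2 ≤ δ ^ 2 := by
        rw [← sq_abs η]; exact pow_le_pow_left₀ (abs_nonneg η) hη 2
      have h'' : δ ^ 2 ≤ δ := by nlinarith only [hδ0, hδ1]
      exact h'.trans h''
    have h2 : 16 * a ^ 2 * η ^ 2 * M ^ 2 ≤ P * δ := by
      rw [hP, show 16 * a ^ 2 * η ^ 2 * M ^ 2 = 16 * a ^ 2 * M ^ 2 * η ^ 2 by ring]
      exact mul_le_mul_of_nonneg_left h1 (by positivity)
    have h3 : P * δ ≤ lam ^ 2 / 2 := by
      refine (mul_le_mul_of_nonneg_left hδ3 hP0).trans ?_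
      rw [mul_div_assoc', div_le_div_iff₀ (by positivity) (by positivity)]
      nlinarith only [hP0, sq_nonneg lam]
    have h4 : 2 * B / (π * R) ≤ lam ^ 2 / 2 := by
      have e : 2 * B / (π * R) = (2 * B / π) / R := by rw [div_div]
      rw [e]
      refine le_trans ?_ hM1
      exact div_le_div_of_nonneg_right
        (div_le_div_of_nonneg_right (by linarith only [hBle]) Real.pi_pos.le) hM.le
    rw [hX]
    linarith only [h2, h3, h4]
  -- the difference kernel is pointwise `≤ λ`
  set k : ℝ → ℂ := weilConv g (weilReflect g) with hk
  set d : ℝ → ℂ := (fun t ↦ k ((1 + η) * t)) - k with hd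
  have hdM : ∀ t, ‖d t‖ ≤ lam := by
    intro t
    have h := norm_dilate_sub_le hg ha hsupp hη2 hlam0 hXmod t
    rw [hN, mul_one] at h
    have h' : lam⁻¹ * X ≤ lam := by
      calc lam⁻¹ * X ≤ lam⁻¹ * lam ^ 2 := mul_le_mul_of_nonneg_left hXle (inv_nonneg.2 hlam0.le)
        _ = lam := by rw [pow_two, ← mul_assoc, inv_mul_cancel₀ hlam0.ne', one_mul]
    exact h.trans (by linarith)
  have hdt : IsWeilTest d := isWeilTest_dilate_sub hg hη1
  have hds : tsupport d ⊆ Icc (-(4 * a)) (4 * a) := tsupport_dilate_sub_subset hg hsupp hη2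
  have hPr : ‖weilPrimeTerm d‖ ≤ 2 * lam * S₄ := by
    have h := norm_weilPrimeTerm_le_of_tsupport_subset hdt.1.continuous hds hdM
    rwa [← hS₄] at h
  have hPrS : ‖weilSemilocalPrimeTerm S d‖ ≤ 2 * lam * S₄ := by
    have h := norm_weilSemilocalPrimeTerm_le_of_tsupport_subset S hdt.1.continuous hds hdM
    rwa [← hS₄] at h
  -- assembly
  have e1 : |(weilPrimeTerm d).re| ≤ ‖weilPrimeTerm d‖ := Complex.abs_re_le_norm _
  have e2 : |(weilSemilocalPrimeTerm S d).re| ≤ ‖weilSemilocalPrimeTerm S d‖ := Complex.abs_re_le_norm _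
  have key : |(weilQuadratic (weilDilate η g)).re - (weilQuadratic g).re + (weilPrimeTerm d).re -
      (weilSemilocalPrimeTerm S d).re| ≤
      |(weilQuadratic (weilDilate η g)).re - (weilQuadratic g).re| + |(weilPrimeTerm d).re| +
        |(weilSemilocalPrimeTerm S d).re| := by
    have h1 := abs_sub ((weilQuadratic (weilDilate η g)).re - (weilQuadratic g).re + (weilPrimeTerm d).re)
      (weilSemilocalPrimeTerm S d).re
    have h2 := abs_add_le ((weilQuadratic (weilDilate η g)).re - (weilQuadratic g).re) (weilPrimeTerm d).re
    linarith
  linarith only [key, hfull, e1, e2, hPr, hPrS, hlamS, hε]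

end Summit.RiemannHypothesis.RiemannHypothesis.Theorems.HandoffSemilocalEnergy

end
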